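import Literature.Computability.AlgebraicComplexity.LadermanStabilizerExact
import HarnessLib

/-!
# The stabiliser of Laderman's scheme over `ℤ₂` is `S₄` (Burichenko 2015, Thm. 1.1: `Aut(L) ≅ S₄`)

Topic `Literature/Computability/AlgebraicComplexity`; a corollary file of
`LadermanStabilizerZ2.lean` (existence: `24` pairwise distinct elements `LadermanZ2.stab i` of KM's
group `G` fix Laderman's scheme mod `2`) and `LadermanStabilizerExact.lean` (exactness: every
element of `G` fixing the scheme is one of them as a linear map, and is one of `24` explicit
normal forms `Exact.nfMap τ`, `τ ∈ Exact.survivors`). Here the stabiliser is packaged as what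
Burichenko's `Aut(L)` is — a GROUP — and identified with `S₄`:

* `LadermanZ2.stabilizer`: the linear maps underlying the elements of `G` (the tree's
  `InSymmetryGroup`: generated by the sandwiches, the cyclic shift and the transposition under
  composition and inverses) that map `LadermanZ2.scheme` to itself, a subgroup of the automorphism
  group of the tensor space; it is the set of the `24` maps `(stab i).toLinearEquiv`
  (`mem_stabilizer_iff`) and has order `24` (`burichenko2015_card_stabilizer`);
* it permutes the `23` terms (`act`), and four of them — the terms indexed
  `Sum.inr (Sum.inr (Sum.inr (Sum.inr a.succ)))`, `a : Fin 4` (`ι4`) — form an orbit on which it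
  acts faithfully (kernel check on the `24` normal forms: `act4_exists`, `act4_faithful`), whence a
  group isomorphism `stabilizer ≃* Equiv.Perm (Fin 4)` (`burichenko2015_stabilizer_mulEquiv`,
  injective by faithfulness, bijective by `24 = 4!`): **`Aut(L) ≅ S₄`**
  (`burichenko2015_laderman_aut_S4`);
* Burichenko §5.3 as printed: its orbits on the `23` terms are `Σ₁ = {1,3,6,10,11,14}`,
  `Σ₂ = {2,5,8,9,13,15,17,18}`, `Ω₄ = {4,7,12,16}`, `Ω₇ = {19}`, `Ω₈ = {20,21,22,23}`
  (`burichenko2015_laderman_term_orbits`, kernel tables `act_block_table`, `reach_table`; the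
  tree lists Laderman's terms in Laderman's numbering, `pos`).

HONEST FRAMING: Burichenko proves `Aut(L) ≅ S₄` over any field (with signs, `Aut` taken inside the
group of decomposable automorphisms with the factor permutations); typed here is the statement for
Laderman's scheme READ MOD `2` and KM's `G` over `ℤ₂` as the tree generates it.

## References

* V. P. Burichenko, *Symmetries of matrix multiplication algorithms. I*, arXiv:1508.01110 (2015),
  Thm. 1.1, §5.3. [Burichenko2015SymI]
* J. D. Laderman, *A noncommutative algorithm for multiplying 3 × 3 matrices using 23
  multiplications*, Bull. AMS 82 (1976), p. 127. [Laderman1976]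
* M. Kauers, J. Moosbauer, *Flip Graphs for Matrix Multiplication*, ISSAC 2023, arXiv:2212.01175,
  §2 (symmetry group). [KauersMoosbauer2022FlipGraphs]
-/

set_option Elab.async false
set_option maxRecDepth 100000

namespace Literature.Computability.AlgebraicComplexity

open Matrix FlipGraph

namespace LadermanZ2

/-! ## §1 The stabiliser as a subgroup of the automorphisms of the tensor space -/

/-- **The stabiliser of Laderman's scheme mod `2` in KM's symmetry group `G`**, as a subgroup of the
group of linear automorphisms of the tensor space `(ℤ₂^{3×3})^{⊗3}`: the linear maps underlying the
elements of `G` (`InSymmetryGroup`) that map the scheme to itself (closed under composition,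
identity and inverses by `Scheme.map_trans`, `Scheme.map_refl`, `Scheme.map_map_symm`).
[cite: Burichenko2015SymI, Thm. 1.1 (`Aut(L)`); KauersMoosbauer2022FlipGraphs, §2 (symmetry group)] -/
def stabilizer : Subgroup (Tn (ZMod 2) 3 ≃ₗ[ZMod 2] Tn (ZMod 2) 3) where
  carrier := {e | ∃ φ : Symmetry (matMulTensor (ZMod 2) 3 3 3),
    InSymmetryGroup φ ∧ scheme.map φ = scheme ∧ φ.toLinearEquiv = e}
  mul_mem' := by
    rintro e f ⟨φ, hφ, hφs, rfl⟩ ⟨ψ, hψ, hψs, rfl⟩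
    exact ⟨ψ.trans φ, hψ.trans hφ, by rw [Scheme.map_trans, hψs, hφs], rfl⟩
  one_mem' := ⟨Symmetry.refl _, InSymmetryGroup.refl, Scheme.map_refl _, rfl⟩
  inv_mem' := by
    rintro e ⟨φ, hφ, hφs, rfl⟩
    refine ⟨φ.symm, hφ.symm, ?_, rfl⟩
    calc scheme.map φ.symm = (scheme.map φ).map φ.symm := by rw [hφs]
      _ = scheme := Scheme.map_map_symm φ scheme

/-- Membership, by definition. [cite: Burichenko2015SymI, Thm. 1.1] -/
theorem mem_stabilizer {e : Tn (ZMod 2) 3 ≃ₗ[ZMod 2] Tn (ZMod 2) 3} :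
    e ∈ stabilizer ↔ ∃ φ : Symmetry (matMulTensor (ZMod 2) 3 3 3),
      InSymmetryGroup φ ∧ scheme.map φ = scheme ∧ φ.toLinearEquiv = e := Iff.rfl

/-- **The stabiliser consists of the `24` listed maps** (existence `stab_mem_fix` + exactness
`burichenko2015_laderman_stabilizer_exact`). [cite: Burichenko2015SymI, Thm. 1.1] -/
theorem mem_stabilizer_iff {e : Tn (ZMod 2) 3 ≃ₗ[ZMod 2] Tn (ZMod 2) 3} :
    e ∈ stabilizer ↔ ∃ i : Fin 24, e = (stab i).toLinearEquiv := by
  constructor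
  · rintro ⟨φ, hφ, hφs, rfl⟩
    exact burichenko2015_laderman_stabilizer_exact hφ hφs
  · rintro ⟨i, rfl⟩
    exact ⟨stab i, (stab_mem_fix i).1, (stab_mem_fix i).2, rfl⟩

/-- The stabiliser as a set is the range of `i ↦ (stab i).toLinearEquiv`. [cite: Burichenko2015SymI, Thm. 1.1] -/
theorem coe_stabilizer :
    (stabilizer : Set (Tn (ZMod 2) 3 ≃ₗ[ZMod 2] Tn (ZMod 2) 3)) =
      Set.range fun i : Fin 24 => (stab i).toLinearEquiv := by
  ext e
  rw [SetLike.mem_coe, mem_stabilizer_iff, Set.mem_range]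
  exact ⟨fun ⟨i, h⟩ => ⟨i, h.symm⟩, fun ⟨i, h⟩ => ⟨i, h.symm⟩⟩

/-- The stabiliser is in bijection with `Fin 24`. [cite: Burichenko2015SymI, Thm. 1.1] -/
noncomputable def stabilizerEquivFin : stabilizer ≃ Fin 24 :=
  (Equiv.setCongr coe_stabilizer).trans (Equiv.ofInjective _ stab_injective).symm

/-- The stabiliser is finite. [cite: Burichenko2015SymI, Thm. 1.1] -/
instance : Finite stabilizer := Finite.of_equiv _ stabilizerEquivFin.symm

/-- **Burichenko 2015, Thm. 1.1 over `ℤ₂`, as a cardinality: the stabiliser of Laderman's scheme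
(mod `2`) in KM's symmetry group `G` is a group of order `24`.** [cite: Burichenko2015SymI, Thm. 1.1] -/
theorem burichenko2015_card_stabilizer : Nat.card stabilizer = 24 := by
  have h := Nat.card_congr stabilizerEquivFin
  rw [Nat.card_eq_fintype_card (α := Fin 24), Fintype.card_fin] at h
  exact h

/-! ## §2 The action on the `23` terms -/

/-- Laderman's term `s` mod `2` as a tensor. [cite: KauersMoosbauer2022FlipGraphs, §4, Def. 1] -/
def term (s : LadermanIndex) : Tn (ZMod 2) 3 := triad (W s) (U s) (V s)

/-- `ℤ₂ = {0, 1}`. [folklore] -/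
private theorem zmod2_eq : ∀ x : ZMod 2, x = 0 ∨ x = 1 := by decide

/-- Distinct indices give distinct terms (no two terms share a factor). [cite: KauersMoosbauer2022FlipGraphs, §4] -/
theorem term_injective : Function.Injective term := by
  intro s s' h
  by_contra hne
  exact (pairwise_ne s s' hne).1 (triad_factors_eq_of_two zmod2_eq h (triad_ne_zero s)).1

/-- A stabiliser element maps every term to a term. [cite: KauersMoosbauer2022FlipGraphs, §2 (symmetry group)] -/
theorem exists_act (e : stabilizer) (s : LadermanIndex) :
    ∃ s', (e : Tn (ZMod 2) 3 ≃ₗ[ZMod 2] Tn (ZMod 2) 3) (term s) = term s' := by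
  obtain ⟨φ, _, hφs, hφe⟩ := e.2
  obtain ⟨s', h⟩ := Exact.exists_image_term hφs s
  exact ⟨s', by rw [← hφe]; exact h⟩

/-- **The permutation action of the stabiliser on the term indices.** [cite: Burichenko2015SymI, Thm. 1.1] -/
noncomputable def act (e : stabilizer) (s : LadermanIndex) : LadermanIndex :=
  Classical.choose (exists_act e s)

/-- Defining property of `act`. [cite: Burichenko2015SymI, Thm. 1.1] -/
theorem apply_term (e : stabilizer) (s : LadermanIndex) :
    (e : Tn (ZMod 2) 3 ≃ₗ[ZMod 2] Tn (ZMod 2) 3) (term s) = term (act e s) :=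
  Classical.choose_spec (exists_act e s)

/-- `act` is determined by the image. [cite: Burichenko2015SymI, Thm. 1.1] -/
theorem act_eq_of_apply {e : stabilizer} {s s' : LadermanIndex}
    (h : (e : Tn (ZMod 2) 3 ≃ₗ[ZMod 2] Tn (ZMod 2) 3) (term s) = term s') : act e s = s' :=
  term_injective ((apply_term e s).symm.trans h)

/-- The identity acts trivially. [cite: Burichenko2015SymI, Thm. 1.1 (`Aut(L)` acts on the terms)] -/
theorem act_one (s : LadermanIndex) : act 1 s = s := act_eq_of_apply rfl

/-- Products act by composition. [cite: Burichenko2015SymI, Thm. 1.1 (`Aut(L)` acts on the terms)] -/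
theorem act_mul (e f : stabilizer) (s : LadermanIndex) : act (e * f) s = act e (act f s) :=
  act_eq_of_apply (by
    show (e : Tn (ZMod 2) 3 ≃ₗ[ZMod 2] Tn (ZMod 2) 3) ((f : Tn (ZMod 2) 3 ≃ₗ[ZMod 2] Tn (ZMod 2) 3)
      (term s)) = _
    rw [apply_term, apply_term])

/-! ## §3 The faithful orbit of four terms (kernel checks on the `24` normal forms) -/

/-- The `m`-th surviving normal form. [cite: Burichenko2015SymI, Thm. 1.1] -/
def surv (m : Fin 24) : ℕ × ℕ × ℕ × ℕ := Exact.survivors.getD m.val (0, 0, 0, 0)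

/-- A normal form `(k, P, Q, R)` acting on code triples. [cite: HeuleKauersSeidl2021, §4] -/
def actT (τ : ℕ × ℕ × ℕ × ℕ) (t : Exact.Tri) : Exact.Tri := Exact.actC τ.1 τ.2.1 τ.2.2.1 τ.2.2.2 t

/-- The survivors' matrices are invertible (members of `gl`). [folklore] -/
private theorem surv_gl : ∀ m : Fin 24,
    (surv m).2.1 ∈ Exact.gl ∧ (surv m).2.2.1 ∈ Exact.gl ∧ (surv m).2.2.2 ∈ Exact.gl := by decide

/-- **Every stabiliser element is one of the `24` normal forms, and acts on terms through it on
codes.** [cite: Burichenko2015SymI, Thm. 1.1] -/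
theorem exists_surv (e : stabilizer) : ∃ m : Fin 24,
    (∀ T, (e : Tn (ZMod 2) 3 ≃ₗ[ZMod 2] Tn (ZMod 2) 3) T = Exact.nfMap (surv m) T) ∧
    ∀ s, (e : Tn (ZMod 2) 3 ≃ₗ[ZMod 2] Tn (ZMod 2) 3) (term s) = Exact.tr3 (actT (surv m) (Exact.cs s)) := by
  obtain ⟨φ, hφ, hφs, hφe⟩ := e.2
  obtain ⟨m, hm⟩ := Exact.exists_fin_nfMap hφ hφs
  have hm' : ∀ T, (e : Tn (ZMod 2) 3 ≃ₗ[ZMod 2] Tn (ZMod 2) 3) T = Exact.nfMap (surv m) T :=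
    fun T => by rw [← hφe]; exact hm T
  refine ⟨m, hm', fun s => ?_⟩
  obtain ⟨hp, hq, hr⟩ := surv_gl m
  rw [hm', term, ← Exact.tr3_cs, Exact.nfMap]
  exact Exact.nf_tr3 _ hp hq hr _

/-- The four terms of the faithful orbit. [cite: Burichenko2015SymI, Thm. 1.1] -/
def ι4 (a : Fin 4) : LadermanIndex := Sum.inr (Sum.inr (Sum.inr (Sum.inr a.succ)))

/-- `ι4` is injective. [folklore] -/
theorem ι4_injective : Function.Injective ι4 := by
  intro a b h
  simpa [ι4, Fin.succ_inj] using h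

/-- Kernel check: every normal form maps the four orbit terms among themselves.
[cite: Burichenko2015SymI, Thm. 1.1] -/
theorem act4_exists : ∀ m : Fin 24, ∀ a : Fin 4, ∃ b : Fin 4,
    actT (surv m) (Exact.cs (ι4 a)) = Exact.cs (ι4 b) := by decide +kernel

/-- Kernel check: only the normal form no. `3` (`(0, I, I, I)`) fixes the four orbit terms.
[cite: Burichenko2015SymI, Thm. 1.1] -/
theorem act4_faithful : ∀ m : Fin 24,
    (∀ a : Fin 4, actT (surv m) (Exact.cs (ι4 a)) = Exact.cs (ι4 a)) → m = 3 := by decide +kernel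

/-- Normal form no. `3` is `(0, 273, 273, 273)`, i.e. word `1` and `P = Q = R = I`. [folklore] -/
private theorem surv_three : surv 3 = (0, 273, 273, 273) := by decide

/-- Code `273` is the identity matrix. [folklore] -/
private theorem matC_273' : Exact.matC 273 = 1 := by decide

/-- Normal form no. `3` is the identity map. [folklore] -/
private theorem nfMap_surv_three (T : Tn (ZMod 2) 3) : Exact.nfMap (surv 3) T = T := by
  rw [surv_three, Exact.nfMap]
  show swAct (Exact.matC 273) (Exact.matC 273) (Exact.matC 273) T = T
  rw [matC_273', swAct_one]

/-- A stabiliser element maps orbit terms to orbit terms. [cite: Burichenko2015SymI, Thm. 1.1] -/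
theorem exists_act_ι4 (e : stabilizer) (a : Fin 4) : ∃ b : Fin 4, act e (ι4 a) = ι4 b := by
  obtain ⟨m, -, hm⟩ := exists_surv e
  obtain ⟨b, hb⟩ := act4_exists m a
  refine ⟨b, act_eq_of_apply ?_⟩
  rw [hm, hb, Exact.tr3_cs, term]

/-- The induced map on `Fin 4`. [cite: Burichenko2015SymI, Thm. 1.1] -/
noncomputable def p4 (e : stabilizer) (a : Fin 4) : Fin 4 := Classical.choose (exists_act_ι4 e a)

/-- Defining property of `p4`. [cite: Burichenko2015SymI, Thm. 1.1] -/
theorem act_ι4 (e : stabilizer) (a : Fin 4) : act e (ι4 a) = ι4 (p4 e a) :=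
  Classical.choose_spec (exists_act_ι4 e a)

/-- `p4 1 = id`. [cite: Burichenko2015SymI, Thm. 1.1 (`Aut(L)` acts on the terms)] -/
theorem p4_one (a : Fin 4) : p4 1 a = a :=
  ι4_injective (by rw [← act_ι4, act_one])

/-- `p4 (e f) = p4 e ∘ p4 f`. [cite: Burichenko2015SymI, Thm. 1.1 (`Aut(L)` acts on the terms)] -/
theorem p4_mul (e f : stabilizer) (a : Fin 4) : p4 (e * f) a = p4 e (p4 f a) :=
  ι4_injective (by rw [← act_ι4, act_mul, act_ι4, act_ι4])

/-- The induced permutation of `Fin 4`. [cite: Burichenko2015SymI, Thm. 1.1] -/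
noncomputable def perm4 (e : stabilizer) : Equiv.Perm (Fin 4) where
  toFun := p4 e
  invFun := p4 e⁻¹
  left_inv a := by
    show p4 e⁻¹ (p4 e a) = a
    rw [← p4_mul, inv_mul_cancel, p4_one]
  right_inv a := by
    show p4 e (p4 e⁻¹ a) = a
    rw [← p4_mul, mul_inv_cancel, p4_one]

/-- **The permutation representation of the stabiliser on the faithful orbit.**
[cite: Burichenko2015SymI, Thm. 1.1] -/
noncomputable def permRep : stabilizer →* Equiv.Perm (Fin 4) where
  toFun := perm4
  map_one' := Equiv.ext fun a => p4_one a
  map_mul' e f := Equiv.ext fun a => p4_mul e f a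

/-- `permRep e a = p4 e a`. [cite: Burichenko2015SymI, Thm. 1.1] -/
theorem permRep_apply (e : stabilizer) (a : Fin 4) : permRep e a = p4 e a := rfl

/-- **Faithfulness:** a stabiliser element acting trivially on the four orbit terms is the identity.
[cite: Burichenko2015SymI, Thm. 1.1] -/
theorem permRep_injective : Function.Injective permRep := by
  rw [injective_iff_map_eq_one]
  intro e he
  obtain ⟨m, hmT, hm⟩ := exists_surv e
  -- the normal form of `e` fixes the four orbit code triples
  have hfix : ∀ a : Fin 4, actT (surv m) (Exact.cs (ι4 a)) = Exact.cs (ι4 a) := by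
    intro a
    obtain ⟨b, hb⟩ := act4_exists m a
    have hpa : p4 e a = a := by rw [← permRep_apply, he]; rfl
    have himg : (e : Tn (ZMod 2) 3 ≃ₗ[ZMod 2] Tn (ZMod 2) 3) (term (ι4 a)) = term (ι4 b) := by
      rw [hm, hb, Exact.tr3_cs, term]
    have hab : ι4 a = ι4 b := by rw [← act_eq_of_apply himg, act_ι4, hpa]
    rw [hb, ← hab]
  -- hence it is normal form no. 3, the identity
  have hm3 : m = 3 := act4_faithful m hfix
  subst hm3
  apply Subtype.ext
  refine LinearEquiv.ext fun T => ?_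
  rw [hmT]
  exact nfMap_surv_three T

/-! ## §4 `Aut(L) ≅ S₄` -/

/-- `|S₄| = 24`: `Perm (Fin 4) ≃ Fin 24`. [folklore] -/
noncomputable def permFinFourEquiv : Equiv.Perm (Fin 4) ≃ Fin 24 :=
  Fintype.equivFinOfCardEq (by rw [Fintype.card_perm, Fintype.card_fin]; rfl)

/-- **The permutation representation is bijective** (injective by faithfulness; both groups have
`24` elements). [cite: Burichenko2015SymI, Thm. 1.1] -/
theorem permRep_bijective : Function.Bijective permRep :=
  ⟨permRep_injective,
    (Finite.injective_iff_surjective_of_equiv (stabilizerEquivFin.trans permFinFourEquiv.symm)).mp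
      permRep_injective⟩

/-- **Burichenko 2015, Thm. 1.1 over `ℤ₂`: `Aut(L) ≅ S₄`.** The stabiliser of Laderman's scheme
(mod `2`) in KM's symmetry group `G`, as a group of linear maps of the tensor space, is isomorphic to
the symmetric group on four letters, via its faithful action on the orbit of the four terms `ι4`.
[cite: Burichenko2015SymI, Thm. 1.1] -/
noncomputable def burichenko2015_stabilizer_mulEquiv : stabilizer ≃* Equiv.Perm (Fin 4) :=
  MulEquiv.ofBijective permRep permRep_bijective

/-- **Burichenko 2015, Thm. 1.1 over `ℤ₂` (`Aut(L) ≅ S₄`), as a proposition.**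
[cite: Burichenko2015SymI, Thm. 1.1] -/
theorem burichenko2015_laderman_aut_S4 : Nonempty (stabilizer ≃* Equiv.Perm (Fin 4)) :=
  ⟨burichenko2015_stabilizer_mulEquiv⟩

/-! ## §5 The orbits of `Aut(L)` on the `23` terms (Burichenko §5.3) -/

/-- The position `0, …, 22` of a term index (the tree lists Laderman's terms in Laderman's order
`m₁, …, m₂₃`). [cite: Laderman1976, p. 127] -/
def pos : LadermanIndex → ℕ
  | Sum.inl i => i.val
  | Sum.inr (Sum.inl i) => 3 + i.val
  | Sum.inr (Sum.inr (Sum.inl i)) => 8 + i.val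
  | Sum.inr (Sum.inr (Sum.inr (Sum.inl i))) => 13 + i.val
  | Sum.inr (Sum.inr (Sum.inr (Sum.inr i))) => 18 + i.val

/-- **Burichenko's partition of the term numbers `1, …, 23`** into `Σ₁ = {1,3,6,10,11,14}` (block
`0`), `Σ₂ = {2,5,8,9,13,15,17,18}` (block `1`), `Ω₄ = {4,7,12,16}` (block `2`), `Ω₇ = {19}` (block
`3`) and `Ω₈ = {20,21,22,23}` (block `4`), as the block number of the term at each position.
[cite: Burichenko2015SymI, §5.3 ("the sets `Σ₁, Σ₂, Ω₄, Ω₇, Ω₈` are `G`-orbits")] -/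
def block (s : LadermanIndex) : ℕ :=
  [0, 1, 0, 2, 1, 0, 2, 1, 1, 0, 0, 2, 1, 0, 1, 2, 1, 1, 3, 4, 4, 4, 4].getD (pos s) 0

/-- The block sizes `|Σ₁|, |Σ₂|, |Ω₄|, |Ω₇|, |Ω₈| = 6, 8, 4, 1, 4`. [cite: Burichenko2015SymI, §5.3] -/
theorem block_sizes :
    ((Finset.univ.filter fun s => block s = 0).card, (Finset.univ.filter fun s => block s = 1).card,
      (Finset.univ.filter fun s => block s = 2).card, (Finset.univ.filter fun s => block s = 3).card,
      (Finset.univ.filter fun s => block s = 4).card) = (6, 8, 4, 1, 4) := by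
  decide

/-- A representative of each block (`m₁, m₂, m₄, m₁₉, m₂₀`). [cite: Burichenko2015SymI, §5.3] -/
def blockRep : ℕ → LadermanIndex
  | 0 => Sum.inl 0
  | 1 => Sum.inl 1
  | 2 => Sum.inr (Sum.inl 0)
  | 3 => Sum.inr (Sum.inr (Sum.inr (Sum.inr 0)))
  | _ => Sum.inr (Sum.inr (Sum.inr (Sum.inr 1)))

set_option maxHeartbeats 4000000 in
/-- Kernel check: every one of the `24` normal forms maps every term to a term of the same block.
[cite: Burichenko2015SymI, §5.3] -/
theorem act_block_table : ∀ m : Fin 24, ∀ s : LadermanIndex, ∃ s' : LadermanIndex,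
    actT (surv m) (Exact.cs s) = Exact.cs s' ∧ block s' = block s := by
  decide +kernel

set_option maxHeartbeats 4000000 in
/-- Kernel check: every term is reached from its block's representative by one of the `24` normal
forms. [cite: Burichenko2015SymI, §5.3] -/
theorem reach_table : ∀ s : LadermanIndex, ∃ m : Fin 24,
    actT (surv m) (Exact.cs (blockRep (block s))) = Exact.cs s := by
  decide +kernel

/-- The action preserves the blocks. [cite: Burichenko2015SymI, §5.3] -/
theorem block_act (e : stabilizer) (s : LadermanIndex) : block (act e s) = block s := by
  obtain ⟨m, -, hm⟩ := exists_surv e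
  obtain ⟨s', hs', hb⟩ := act_block_table m s
  have h : act e s = s' := act_eq_of_apply (by rw [hm, hs', Exact.tr3_cs, term])
  rw [h, hb]

/-- The normal-form number of a stabiliser element. [cite: Burichenko2015SymI, Thm. 1.1] -/
noncomputable def idx (e : stabilizer) : Fin 24 := Classical.choose (exists_surv e)

/-- Defining property of `idx`. [cite: Burichenko2015SymI, Thm. 1.1] -/
theorem idx_spec (e : stabilizer) (T : Tn (ZMod 2) 3) :
    (e : Tn (ZMod 2) 3 ≃ₗ[ZMod 2] Tn (ZMod 2) 3) T = Exact.nfMap (surv (idx e)) T :=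
  (Classical.choose_spec (exists_surv e)).1 T

/-- `idx` is injective (a map is its normal form). [cite: Burichenko2015SymI, Thm. 1.1] -/
theorem idx_injective : Function.Injective idx := by
  intro e f h
  apply Subtype.ext
  refine LinearEquiv.ext fun T => ?_
  rw [idx_spec e, idx_spec f, h]

/-- `idx` is surjective (`24` elements, `24` normal forms): every normal form is realised.
[cite: Burichenko2015SymI, Thm. 1.1] -/
theorem idx_surjective : Function.Surjective idx :=
  (Finite.injective_iff_surjective_of_equiv stabilizerEquivFin).mp idx_injective

/-- Every normal form is the action of a stabiliser element on the terms. [cite: Burichenko2015SymI, Thm. 1.1] -/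
theorem exists_stabilizer_of_surv (m : Fin 24) : ∃ e : stabilizer, ∀ s,
    (e : Tn (ZMod 2) 3 ≃ₗ[ZMod 2] Tn (ZMod 2) 3) (term s) = Exact.tr3 (actT (surv m) (Exact.cs s)) := by
  obtain ⟨e, rfl⟩ := idx_surjective m
  refine ⟨e, fun s => ?_⟩
  obtain ⟨hp, hq, hr⟩ := surv_gl (idx e)
  rw [idx_spec e, term, ← Exact.tr3_cs, Exact.nfMap]
  exact Exact.nf_tr3 _ hp hq hr _

/-- Terms of the same block are in the same orbit. [cite: Burichenko2015SymI, §5.3] -/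
theorem exists_act_of_block_eq {s s' : LadermanIndex} (h : block s = block s') :
    ∃ e : stabilizer, act e s = s' := by
  obtain ⟨m, hm⟩ := reach_table s
  obtain ⟨m', hm'⟩ := reach_table s'
  obtain ⟨e, he⟩ := exists_stabilizer_of_surv m
  obtain ⟨e', he'⟩ := exists_stabilizer_of_surv m'
  have h1 : act e (blockRep (block s)) = s := act_eq_of_apply (by rw [he, hm, Exact.tr3_cs, term])
  have h2 : act e' (blockRep (block s)) = s' :=
    act_eq_of_apply (by rw [he', h, hm', Exact.tr3_cs, term])
  refine ⟨e' * e⁻¹, ?_⟩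
  have h3 : act e⁻¹ s = blockRep (block s) := by
    conv_lhs => rw [← h1]
    rw [← act_mul, inv_mul_cancel, act_one]
  rw [act_mul, h3, h2]

/-- **Burichenko 2015, §5.3 over `ℤ₂` — the orbits of `Aut(L)` on Laderman's `23` terms:** two terms
(mod `2`) are in the same orbit of the stabiliser iff their numbers lie in the same one of the sets
`Σ₁ = {1,3,6,10,11,14}`, `Σ₂ = {2,5,8,9,13,15,17,18}`, `Ω₄ = {4,7,12,16}`, `Ω₇ = {19}`,
`Ω₈ = {20,21,22,23}`; in particular the orbit sizes are `6, 8, 4, 1, 4` (`block_sizes`).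
[cite: Burichenko2015SymI, §5.3] -/
theorem burichenko2015_laderman_term_orbits (s s' : LadermanIndex) :
    (∃ e : stabilizer, act e s = s') ↔ block s = block s' :=
  ⟨fun ⟨e, he⟩ => by rw [← he, block_act], fun h => exists_act_of_block_eq h⟩


end LadermanZ2

end Literature.Computability.AlgebraicComplexity
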